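import Literature.Topology.FourManifolds.HomotopySpheresSumProofs
import Literature.Topology.FourManifolds.OneManifoldOrbits
import Literature.Topology.FourManifolds.SmoothPoincareLowDim
import Literature.AlgebraicTopology.Homotopy.WhiteheadContractibleLeaves
import Literature.AlgebraicTopology.Homotopy.WhiteheadCWContractible
import HarnessLib

/-!
# Sums of homotopy spheres: dimension `1`, and the reduction to punctured homotopy spheres

Topic `Literature/Topology/FourManifolds`, third proofs file of `HomotopySpheresSum.lean` for the
tree fact `Literature.Topology.FourManifolds.HomotopySphere.nonempty_homotopyEquiv_sphere_of_isConnectedSum`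
(Kervaire–Milnor, *Groups of homotopy spheres I*, Ann. of Math. 77 (1963), §2, p. 505: "It is
clear that the sum of two homotopy `n`-spheres is a homotopy `n`-sphere"; no proof printed).
`HomotopySpheresSum.lean` reduced the fact to the contractibility of a homotopy sphere with an
open disc removed (`HomotopySphere.contractibleSpace_compl_image_ball`), and
`HomotopySpheresSumProofs.lean` proved that for `n = 0`, reduced `n ≥ 3` to the
Whitehead–Hurewicz recognition principle, and `n = 1, 2` to the smooth Poincaré conjecture in
those dimensions (spc4.S32). This file

* **proves the case `n = 1` outright** (`HomotopySphere.contractibleSpace_compl_singleton_one`,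
  `HomotopySphere.contractibleSpace_compl_image_ball_one`): a homotopy `1`-sphere is a compact
  connected oriented smooth `1`-manifold, and such a manifold minus a point is homeomorphic to an
  open interval (`OneManifoldOrbits.lean`: flow of a positive vector field; Milnor 1965,
  Appendix; Kervaire–Milnor 1963, p. 507: "Clearly `Θ₁` is zero");
* records the resulting **one-fact reduction**: Kervaire–Milnor's statement, in all dimensions,
  follows from the single named fact `HomotopySphere.contractibleSpace_compl_singleton` of
  `HomotopySpheresInverse.lean` (punctured homotopy `n`-spheres, `n ≥ 2`, are contractible — the
  homotopy theory in Kervaire–Milnor's Lemma 2.4), everything else proved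
  (`HomotopySphere.nonempty_homotopyEquiv_sphere_of_isConnectedSum_of_compl_singleton`);
* and the reduction to **leaves**: the Whitehead–Hurewicz fact and the smooth Poincaré
  conjecture in dimension `2` only (`nonemptyDiffeomorphSphere_two`, `SmoothPoincareLowDim.lean`;
  classification of surfaces) — compare `…_of_leaves` in `HomotopySpheresGroupLeaves.lean`, which
  also takes the dimension-`1` fact, now superfluous
  (`HomotopySphere.nonempty_homotopyEquiv_sphere_of_isConnectedSum_of_whitehead_of_two`); and one
  level down, Hurewicz (`hurewicz_iso`, Hatcher Thm. 4.32) + Milnor's CW homotopy type of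
  manifolds (`Manifold.exists_cwComplex_homotopyEquiv`, Milnor 1959 Cor. 1) — Whitehead's
  contractibility criterion being PROVED in `WhiteheadCWContractible.lean` — + the dimension-`2`
  fact (`HomotopySphere.nonempty_homotopyEquiv_sphere_of_isConnectedSum_of_hurewicz_of_cwType_of_two`).

No declaration here uses `sorry`; no new named fact is introduced.

## References

* M. Kervaire, J. Milnor, *Groups of homotopy spheres I*, Ann. of Math. 77 (1963), §2 p. 505,
  p. 507. [KervaireMilnorAnnals1963]
* J. Milnor, *Topology from the Differentiable Viewpoint* (1965), Appendix: Classifying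
  one-manifolds. [MilnorTDV1965]
* A. Kosinski, *Differential Manifolds* (1993), Ch. VI §1 (remark before Cor. 1.4), §2
  Prop. 2.1. [Kosinski1993]
* A. Hatcher, *Algebraic Topology* (2002), Thm. 4.5, Thm. 4.32. [HatcherAT2002]
* J. Milnor, *On spaces having the homotopy type of a CW-complex*, Trans. AMS 90 (1959), Cor. 1.
  [Milnor1959]
-/

open scoped Manifold ContDiff Topology ContinuousMap
open Set Function Metric

noncomputable section

namespace Literature.Topology.FourManifolds

/-- Local notation: `𝔼 n` is the model Euclidean space `EuclideanSpace ℝ (Fin n)`. -/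
local notation "𝔼 " n:arg => EuclideanSpace ℝ (Fin n)

/-- Local notation: `𝕊 n` is the unit sphere in `EuclideanSpace ℝ (Fin (n + 1))`. -/
local notation "𝕊 " n:arg => (Metric.sphere (0 : EuclideanSpace ℝ (Fin (n + 1))) 1)

namespace HomotopySphere

/-! ### Dimension `1` -/

/-- **A homotopy `1`-sphere minus a point is contractible** (Kervaire–Milnor 1963, p. 507:
"Clearly `Θ₁` is zero"): a homotopy `1`-sphere is a compact, connected (`n ≠ 0`), oriented smooth
`1`-manifold, so the complement of a point is homeomorphic to an open interval
(`contractibleSpace_compl_singleton_of_smoothOrientation_one`, flow of a positive vector field;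
Milnor 1965, Appendix). This is the case `n = 1` left out of the named fact
`HomotopySphere.contractibleSpace_compl_singleton` (stated for `n ≥ 2`).
[cite: KervaireMilnorAnnals1963, §2 p. 507] -/
theorem contractibleSpace_compl_singleton_one (S : HomotopySphere 1) (p : S.carrier) :
    ContractibleSpace ↥(({p}ᶜ : Set S.carrier)) :=
  haveI := S.connectedSpace one_ne_zero
  contractibleSpace_compl_singleton_of_smoothOrientation_one S.orientation p

/-- **`contractibleSpace_compl_image_ball` in dimension `1`**: a homotopy `1`-sphere with an open
disc removed is contractible — it is a deformation retract (`BallComplement.homotopyEquiv`) of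
the punctured homotopy `1`-sphere, contractible by `contractibleSpace_compl_singleton_one`
(Kosinski 1993, VI §1; Kervaire–Milnor 1963, p. 507). [cite: KervaireMilnorAnnals1963, §2 p. 507] -/
theorem contractibleSpace_compl_image_ball_one (S : HomotopySphere 1) {i : 𝔼 1 → S.carrier}
    (hi : Manifold.IsSmoothEmbedding 𝓘(ℝ, 𝔼 1) (𝓡 1) ∞ i) :
    ContractibleSpace ↥((i '' ball (0 : 𝔼 1) 1)ᶜ) :=
  haveI := S.contractibleSpace_compl_singleton_one (i 0)
  (Literature.AlgebraicTopology.Homotopy.BallComplement.homotopyEquiv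
    (isOpenEmbedding_of_isSmoothEmbedding_euclidean hi)).contractibleSpace

/-! ### The one-fact reduction -/

/-- **`contractibleSpace_compl_image_ball` from the contractibility of punctured homotopy
spheres.** The named fact of `HomotopySpheresSum.lean` (a homotopy `n`-sphere with an open disc
removed is contractible, all `n`; Kosinski 1993, VI §1) follows from the named fact
`HomotopySphere.contractibleSpace_compl_singleton` of `HomotopySpheresInverse.lean` (`Σ ∖ {p}` is
contractible for `n ≥ 2`; Kervaire–Milnor 1963, proof of Lemma 2.4): `Σ ∖ i(B)` is a deformation
retract of `Σ ∖ {i 0}` (`BallComplement.homotopyEquiv`); dimensions `0`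
(`contractibleSpace_compl_image_ball_zero`) and `1` (`contractibleSpace_compl_image_ball_one`) are
proved outright. [cite: Kosinski1993, Ch. VI §1 (remark before Cor. 1.4)] -/
theorem contractibleSpace_compl_image_ball_of_compl_singleton
    (h : contractibleSpace_compl_singleton) : contractibleSpace_compl_image_ball := by
  intro n S i hi
  rcases Nat.lt_or_ge n 2 with hn | hn
  · interval_cases n
    · exact S.contractibleSpace_compl_image_ball_zero i
    · exact S.contractibleSpace_compl_image_ball_one hi
  · haveI : ContractibleSpace ↥(({i 0}ᶜ : Set S.carrier)) := h n S (i 0) hn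
    exact (Literature.AlgebraicTopology.Homotopy.BallComplement.homotopyEquiv
      (isOpenEmbedding_of_isSmoothEmbedding_euclidean hi)).contractibleSpace

/-- **The sum of two homotopy spheres is a homotopy sphere, GIVEN only that punctured homotopy
spheres (`n ≥ 2`) are contractible.** Kervaire–Milnor's statement (*Groups of homotopy spheres
I* (1963), §2, p. 505; tree fact `HomotopySphere.nonempty_homotopyEquiv_sphere_of_isConnectedSum`,
all `n`) follows from the single named fact `HomotopySphere.contractibleSpace_compl_singleton`
(the homotopy theory of Kervaire–Milnor's Lemma 2.4, p. 507): the suspension argument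
(`nonempty_homotopyEquiv_sphere_of_isConnectedSum_of`), the disc-complement retraction and
dimensions `0, 1` are proved. [cite: KervaireMilnorAnnals1963, §2 (p. 505)] -/
theorem nonempty_homotopyEquiv_sphere_of_isConnectedSum_of_compl_singleton
    (h : contractibleSpace_compl_singleton) : nonempty_homotopyEquiv_sphere_of_isConnectedSum :=
  nonempty_homotopyEquiv_sphere_of_isConnectedSum_of
    (contractibleSpace_compl_image_ball_of_compl_singleton h)

/-- **The sum of two homotopy spheres is a homotopy sphere, from Whitehead–Hurewicz and the
smooth Poincaré conjecture in dimension `2` only.** Compared with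
`nonempty_homotopyEquiv_sphere_of_isConnectedSum_of_facts` (`HomotopySpheresSumProofs.lean`), the
dimension-`1` instance of spc4.S32 is no longer needed. Inputs: the Whitehead–Hurewicz
recognition principle for manifolds
(`Literature.AlgebraicTopology.Homotopy.Manifold.contractibleSpace_of_simplyConnected_of_acyclic`;
Bredon 1993, VII Cor. 10.11 + Milnor 1959, Cor. 1), used for `n ≥ 3`, and the smooth Poincaré
conjecture in dimension `2` (`nonemptyDiffeomorphSphere_two`, `SmoothPoincareLowDim.lean`:
classification of surfaces; Kervaire–Milnor p. 507, "`Θ₂ = 0`"), used for `n = 2`, both through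
`contractibleSpace_compl_singleton_of`. [cite: KervaireMilnorAnnals1963, §2 (p. 505)] -/
theorem nonempty_homotopyEquiv_sphere_of_isConnectedSum_of_whitehead_of_two
    (hW : Literature.AlgebraicTopology.Homotopy.Manifold.contractibleSpace_of_simplyConnected_of_acyclic.{0})
    (h2 : nonemptyDiffeomorphSphere_two.{0}) :
    nonempty_homotopyEquiv_sphere_of_isConnectedSum :=
  nonempty_homotopyEquiv_sphere_of_isConnectedSum_of_compl_singleton
    (contractibleSpace_compl_singleton_of hW fun M _ _ _ => h2 M)

/-- **The sum of two homotopy spheres is a homotopy sphere, from three leaves one level down**: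
(a) the Hurewicz theorem (`Literature.AlgebraicTopology.SingularHomology.hurewicz_iso`, Hatcher
2002, Thm. 4.32), (b) Milnor's theorem that second countable Hausdorff manifolds have the
homotopy type of CW complexes (`Literature.AlgebraicTopology.Homotopy.Manifold.exists_cwComplex_homotopyEquiv`,
Milnor 1959, Cor. 1), and (c) the smooth Poincaré conjecture in dimension `2`
(`nonemptyDiffeomorphSphere_two`; classification of surfaces); Whitehead's contractibility
criterion for CW complexes is the PROVED tree theorem
`whitehead_contractibleSpace_of_subsingleton_homotopyGroup` (`WhiteheadCWContractible.lean`,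
Hatcher Thm. 4.5), and the three combine to the Whitehead–Hurewicz principle by
`Manifold.contractibleSpace_of_simplyConnected_of_acyclic_of_facts`. Everything else — the
suspension argument, Mayer–Vietoris and general position for punctured homotopy spheres, Palais'
disc theorem, flows on `1`-manifolds, dimensions `0` and `1` — is proved.
[cite: KervaireMilnorAnnals1963, §2 (p. 505)] -/
theorem nonempty_homotopyEquiv_sphere_of_isConnectedSum_of_hurewicz_of_cwType_of_two
    (h432 : Literature.AlgebraicTopology.SingularHomology.hurewicz_iso.{0})
    (hCW : Literature.AlgebraicTopology.Homotopy.Manifold.exists_cwComplex_homotopyEquiv.{0})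
    (h2 : nonemptyDiffeomorphSphere_two.{0}) :
    nonempty_homotopyEquiv_sphere_of_isConnectedSum :=
  nonempty_homotopyEquiv_sphere_of_isConnectedSum_of_whitehead_of_two
    (Literature.AlgebraicTopology.Homotopy.Manifold.contractibleSpace_of_simplyConnected_of_acyclic_of_facts
      h432
      (fun X _ _ _ _ hX =>
        Literature.AlgebraicTopology.Homotopy.whitehead_contractibleSpace_of_subsingleton_homotopyGroup X hX)
      hCW)
    h2

end HomotopySphere

end Literature.Topology.FourManifolds
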